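import Summits.CriticalPhenomena.PercolationContinuityZ3.Theorems.Transplant.SkelFrmQuasiBChoiceSlotsPx
import Summits.CriticalPhenomena.PercolationContinuityZ3.Theorems.Transplant.SkelFrmQuasiBChoiceGeomVPx
import Summits.CriticalPhenomena.PercolationContinuityZ3.Theorems.Transplant.SkelFrmQuasi1RootHoldsQ3VNodePx
import Summits.CriticalPhenomena.PercolationContinuityZ3.Theorems.Transplant.SkelFrmQuasi1FaceHoldsQ3VNodePx
import Summits.CriticalPhenomena.PercolationContinuityZ3.Theorems.Transplant.SkelFrmQuasi1ReachHoldsQ3VNodePx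
import Summits.CriticalPhenomena.PercolationContinuityZ3.Theorems.Transplant.PlanarSkeletonFrmQuasi1Px
import Summits.CriticalPhenomena.PercolationContinuityZ3.Theorems.Transplant.PlanarSkeletonFrmQuasiProxies
import HarnessLib

/-!
# THE QUASI-STEP NODE (rung Q, (N3-b); RULING D-Q, lead g23 2026-08-27; design owner p3 g30): **`θ_t(p_c) = 0` for EVERY locally finite graph carrying a
# `PlanarSkeletonFrmQuasi` (exact-footprint quasi-steps `Skelφ.QStepsN G φ M`, cylinders joined inside a `W`-fattening) with ANY number of base types, at every
# type `t` with proxies `Φ.HasProxies t Dp`, GIVEN subcritical cylinders at `p_c(t)` (the hC-node: Φ2 is the hypothesis, no ray leg)** — the four GEN-Q column tops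
# ∀ `Dp` (Geom «SkelFrmQuasiBChoiceGeomVPx» · (R) «SkelFrmQuasi1RootHoldsQ3VNodePx» · (F) «SkelFrmQuasi1FaceHoldsQ3VNodePx» · (C) «SkelFrmQuasi1ReachHoldsQ3VNodePx»)
# at the tuple Px of record («SkelFrmQuasiBChoiceSlotsPx»/«…DefsVPx») fed into «PlanarSkeletonFrmQuasi1Px» `theta_criticalProbIOf_eq_zero_of_choiceFnNQLTKPxAt`

builds on p205010 (kernel theorem, internal audit signed; external expert review pending).  Lane `prim-bschramm`, seat `prim-bschramm-p3` gen 30 (design owner);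
helper file (`--supports stmt-CriticalPhenomena-4575 --as helper`).  THIS FILE IS THE NODE ROW OF RULING D-Q (Q-4): it proves EXACTLY the Prop `hNode` of
«AutCylinderAssembly» p509897 :119 / NODE-SPEC §1 (no new `@[conjecture]`, no node constant) — `frmQuasiNode` below has LITERALLY that type — as the GEN-Q twin of
«SkelFrmFromProxHoldsAll» p486426 §1 with the carrier `PlanarSkeletonFrmFrom ↦ PlanarSkeletonFrmQuasi` and the last argument of the closure,
`Φ.cylSubcritical_criticalProb t` (the ray leg, struck from this rung), REPLACED BY THE HYPOTHESIS `hC : Φ.CylSubcritical (criticalProbIOf G t)`.  Nothing here edits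
or restates a `@[conjecture]`; nothing is claimed about `BenjaminiSchramm1996_conj4_endState` verbatim, chartless classes (b₁ ≤ 1) or general transitive graphs.
WHAT IT CLOSES (already in the tree, conditional on exactly hNode): `AutCyl.conj4_polynomialGrowth_of_frmQuasiNode (hT) frmQuasiNode :
BenjaminiSchramm1996_conj4_polynomialGrowth` (mod `Trofimov1985_polynomialGrowthBlocks`), `AutCyl.conj4_cayley_virtuallyNilpotent_of_frmQuasiNode frmQuasiNode`
(every Cayley graph of polynomial growth of every f.g. virtually nilpotent group — NO named fact), `AutChart.conj4_of_quasiNode_zTwoPeriodic/_zdPeriodic`,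
`Z2Rot.conj4_of_quasiNode` — recomposition pins are the audit's (AUDIT-Q-PLAN), not this file's.
§1 `frmQuasiProx_criticalContinuity_holds (Φ) (ht) (hP) (hC) : θ_t(p_c(G,t)) = 0`; `frmQuasiNode : hNode` verbatim (with the idle `G.Connected` binder of the spec);
`frmQuasiNodeD` (the D-explicit `Connected`-free shape of p5-g28's customers p510187/p511040/p511720/p512718);
the orbit form `…_of_iso` (frames are automorphisms).  (The same-`p` DROP form of p486426 §1 is not restated here: its closure lemma
`PlanarSkeletonFrmQuasi.drop_of_choiceFnNQLTKPxAt_at` is outside the node's used cone and was not ported in G238 — an optional append row later.)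
[cite: BenjaminiSchramm1996, Conj. 4] [cite: KozmaNitzan2024, §1 p. 2 (approach 1); §4 Theorem 6 (pp. 25–31)] [cite: Hutchcroft2016, Thm. 1]
[cite: LyonsPeres2016, Thm. 7.6] [cite: AizenmanGrimmett1991, Thm 1 (essential enhancements)]
-/

noncomputable section

namespace Summit.CriticalPhenomena.PercolationContinuityZ3.Theorems

namespace Transplant

open MeasureTheory Literature.Probability.Percolation Literature.Probability.LatticeModels SimpleGraph
open Literature.Barriers.CriticalPhenomena (graphBall countable_of_connected_of_locallyFinite)
open scoped Classical

/-! ## §1 The multi-type quasi-step carrier with proxies: `θ_t(p_c) = 0` under hC -/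

/-- **`θ_t(p_c) = 0` FOR EVERY `PlanarSkeletonFrmQuasi` — ANY NUMBER OF TYPES — AT EVERY BASE TYPE WITH PROXIES, GIVEN SUBCRITICAL CYLINDERS AT `p_c`**: on a
locally finite graph `G` carrying a quasi-step planar skeleton `Φ` (exact-footprint quasi-steps of cost `Φ.M`, cylinders of half-width `≥ ℓ₀` joined inside their
`W`-fattening), every base type `t ∈ Φ.types` admitting proxies at some radius `Dp` (`Φ.HasProxies t Dp`) with `Φ.CylSubcritical (p_c(G,t))` has `θ_t(p_c(G,t)) = 0`.
The four GEN-Q column tops at the tuple Px of record at radius `Dp` through «PlanarSkeletonFrmQuasi1Px» `theta_criticalProbIOf_eq_zero_of_choiceFnNQLTKPxAt`; Φ2 at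
`p_c` is the HYPOTHESIS `hC` (GEN-Q twin of «SkelFrmFromProxHoldsAll» `frmFromProx_criticalContinuity_holds`, whose last argument was `Φ.cylSubcritical_criticalProb t`).
builds on p205010 (kernel theorem, internal audit signed; external expert review pending). [cite: BenjaminiSchramm1996, Conj. 4] [cite: KozmaNitzan2024, §4] -/
theorem frmQuasiProx_criticalContinuity_holds {V : Type} (G : SimpleGraph V) [G.LocallyFinite] (Φ : PlanarSkeletonFrmQuasi G) {t : V} (ht : t ∈ Φ.types)
    {Dp : ℕ} (hP : Φ.HasProxies t Dp) (hC : Φ.CylSubcritical (criticalProbIOf G t)) : theta G t (criticalProbIOf G t) = 0 :=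
  PlanarSkeletonFrmQuasi.theta_criticalProbIOf_eq_zero_of_choiceFnNQLTKPxAt PlanarSkeletonFrm.NegB.LfQ (fun x : ℝ => x ^ 3) (fun _ hx => pow_pos hx 3) 480
    (PlanarSkeletonFrmQuasi.frmChoiceAllQ3VPx Dp (PlanarSkeletonFrmQuasi.NegB.gvPx Dp) (PlanarSkeletonFrmQuasi.NegB.fvPx Dp) (PlanarSkeletonFrmQuasi.NegB.PvPx Dp)
      (PlanarSkeletonFrmQuasi.NegB.SUS (PlanarSkeletonFrmQuasi.NegB.exPx Dp) (PlanarSkeletonFrmQuasi.NegB.mxPx Dp)) (PlanarSkeletonFrmQuasi.NegB.cvPx Dp)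
      (PlanarSkeletonFrmQuasi.NegB.hvPx Dp) PlanarSkeletonFrmQuasi.NegB.BSlot.small3)
    (PlanarSkeletonFrmQuasi.geomHoldsNQFnPxAt_frmChoiceAllQ3VPx Dp _ _ _ _ _ _ _)
    (PlanarSkeletonFrmQuasi.NegB.rootHoldsNQWFnLKPxAt_frmChoiceAllQ3VPx_node Dp 480 (by norm_num))
    (PlanarSkeletonFrmQuasi.NegB.faceHoldsRNQFnLTKPxAt_frmChoiceAllQ3VPx_node Dp 480 le_rfl)
    (PlanarSkeletonFrmQuasi.reachHoldsRHNQFnLKPxAt_frmChoiceAllQ3VPx_node Dp 480 (by norm_num))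
    Φ ht hP hC

/-- **THE NODE hNode OF RULING D-Q, VERBATIM** («AutCylinderAssembly» :119 / NODE-SPEC §1, binder for binder; the `G.Connected` hypothesis of the spec is idle here —
weaker hypotheses only): feed it to `AutCyl.conj4_polynomialGrowth_of_frmQuasiNode`, `AutCyl.conj4_cayley_virtuallyNilpotent_of_frmQuasiNode`,
`AutChart.conj4_of_quasiNode_zTwoPeriodic/_zdPeriodic`, `Z2Rot.conj4_of_quasiNode` as their `hNode`/`node` argument.
builds on p205010 (kernel theorem, internal audit signed; external expert review pending). [cite: BenjaminiSchramm1996, Conj. 4] -/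
theorem frmQuasiNode : ∀ {W : Type} (G : SimpleGraph W) [G.LocallyFinite], G.Connected → ∀ (Φ : PlanarSkeletonFrmQuasi G) (t : W), t ∈ Φ.types →
    ∀ Dp : ℕ, Φ.HasProxies t Dp → Φ.CylSubcritical (criticalProbIOf G t) → theta G t (criticalProbIOf G t) = 0 :=
  fun G _ _ Φ _ ht _ hP hC => frmQuasiProx_criticalContinuity_holds G Φ ht hP hC

/-- **The node in the D-EXPLICIT, `Connected`-free shape the refuter's customers read** («AutCylinderOfQuasiNode» p510187 :156, «AutChartTreeFiniteKernel»,
«AutChartZdPeriodic», «CayleyZ2RotC4FrmQuasi»: `hNode : ∀ G Φ t D, t ∈ Φ.types → Φ.HasProxies t D → Φ.CylSubcritical (p_c t) → θ_t(p_c) = 0`) — apply it BY NAME.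
builds on p205010 (kernel theorem, internal audit signed; external expert review pending). [cite: BenjaminiSchramm1996, Conj. 4] -/
theorem frmQuasiNodeD : ∀ {W : Type} (G : SimpleGraph W) [G.LocallyFinite] (Φ : PlanarSkeletonFrmQuasi G) (t : W) (D : ℕ),
    t ∈ Φ.types → Φ.HasProxies t D → Φ.CylSubcritical (criticalProbIOf G t) → theta G t (criticalProbIOf G t) = 0 :=
  fun G _ Φ _ _ ht hP hC => frmQuasiProx_criticalContinuity_holds G Φ ht hP hC

/-- **… at every vertex FRAMED FROM `t`**: `θ_v(p_c(G,v)) = 0` for every `v = α t` with `α` a graph automorphism, under hC at `t` (frames are automorphisms: `θ`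
and `p_c` are transported).
builds on p205010 (kernel theorem, internal audit signed; external expert review pending). [cite: BenjaminiSchramm1996, Conj. 4] -/
theorem frmQuasiProx_criticalContinuity_holds_of_iso {V : Type} (G : SimpleGraph V) [G.LocallyFinite] (Φ : PlanarSkeletonFrmQuasi G) {t : V} (ht : t ∈ Φ.types)
    {Dp : ℕ} (hP : Φ.HasProxies t Dp) (hC : Φ.CylSubcritical (criticalProbIOf G t)) (α : G ≃g G) : theta G (α t) (criticalProbIOf G (α t)) = 0 := by
  haveI : Countable V := countable_of_connected_of_locallyFinite G (Φ.graph_connected t) t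
  have hbase := frmQuasiProx_criticalContinuity_holds G Φ ht hP hC
  have hθ := theta_iso α t (criticalProbIOf G t)
  have hpc := criticalProb_iso α t
  have e : criticalProbIOf G (α t) = criticalProbIOf G t := Subtype.ext hpc
  rw [e, hθ]
  exact hbase

end Transplant

end Summit.CriticalPhenomena.PercolationContinuityZ3.Theorems

end
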